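import Literature.AlgebraicGeometry.Surfaces.KugaSatakeVarietyBettiExistsOfK3Type
import Literature.AlgebraicGeometry.HodgeTheory.AbelianVarietyHodgeEssentialImageHolds
import HarnessLib

/-!
# Kuga–Satake varieties EXIST, unconditionally: the `∀ (A, B, θ)` binder of the Kuga–Satake records is inhabited

Family `hodge`, layer `Literature/AlgebraicGeometry/Surfaces`. THEOREMS ONLY (no definition, no named fact).
Sequel of `K3PowersHodgeIffKugaSatakePowers` (`exists_isKugaSatakeVarietyBetti`: Kuga–Satake varieties exist on
the real carriers «GIVEN Riemann's theorem in the form of the tree's record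
`HodgeTheory.DeligneMilne1982_Thm_6_20_essImage` (a THEOREM on the summit side)») and of
`KugaSatakeVarietyBettiExistsOfK3Type` (the orthogonal-pair hypothesis dropped; presentations of the
transcendental part of a surface with `h^{2,0}(T) = 1`), both of which carry the hypothesis
`(hDM : HodgeTheory.DeligneMilne1982_Thm_6_20_essImage)`. That record is now the Literature theorem
`HodgeTheory.DeligneMilne1982_Thm_6_20_essImage_holds` (`HodgeTheory/AbelianVarietyHodgeEssentialImageHolds`:
the polarised torus of a weight-one structure is the analytification of an abelian variety by Lefschetz, Chow and
GAGA, `AbelianVarieties/PolarisedTorusProjective`; its `H¹` is the given structure by the uniformised comparison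
and a dimension count), so the three existence theorems hold outright; this file records them under the primed
names of the originals (`foo'` := `foo DeligneMilne1982_Thm_6_20_essImage_holds`).

Sources, VERBATIM. B. van Geemen, *Kuga-Satake varieties and the Hodge conjecture* (2000), §5.7 / §8.1: the
Kuga–Satake construction «defines an isogeny class of abelian varieties»; S. Floccari (2026), §3.2: «This thus
defines an abelian variety `KS(V)` up to isogeny, such that `H¹(KS(V), ℚ) ≅ C⁺(V)`»; M. Kuga, I. Satake,
*Abelian varieties attached to polarized K3-surfaces*, Math. Ann. 169 (1967) 239–242 (the construction); the
existence of the abelian variety with prescribed weight-one Hodge structure is Riemann's theorem, P. Deligne,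
J. S. Milne, *Tannakian Categories*, LNM 900 (1982), Thm. 6.20.

## References

* [vanGeemen2000KugaSatakeHC] B. van Geemen, Kuga-Satake varieties and the Hodge conjecture (2000), §5.2, §5.7,
  §8.1, §10.2.
* [Floccari2026] S. Floccari (2026), §3.2, Thm. 3.5.
* [DeligneMilne1982Tannakian] P. Deligne, J. S. Milne, Tannakian Categories, LNM 900 (1982), §6 Thm. 6.20.
-/

noncomputable section

namespace Literature.AlgebraicGeometry.Surfaces

open HodgeTheory
open Literature.AlgebraicTopology.SingularHomology

/-- **Kuga–Satake varieties exist** — UNCONDITIONAL form of `exists_isKugaSatakeVarietyBetti`: for a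
finite-dimensional polarized `ℚ`-Hodge structure `(T, H, P)` of K3 type containing an orthogonal pair `e₁, e₂`
with `P(eᵢ, eᵢ) < 0` there are a complex abelian variety `A`, a Hodge-symmetric Hodge model `B` of `A` and
`θ : H¹(A(ℂ); ℚ) ≃ C⁺(Q)` with `IsKugaSatakeVarietyBetti H P _ A B hB θ` (the Kuga–Satake structure on `C⁺(Q)`
is polarisable and effective of weight one, so it is `H¹_B` of an abelian variety by Riemann's theorem
`DeligneMilne1982_Thm_6_20_essImage_holds`). [cite: vanGeemen2000KugaSatakeHC, §5.7 and §8.1]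
[cite: Floccari2026, §3.2] [cite: DeligneMilne1982Tannakian, art. II §6 Thm. 6.20 (Riemann)] -/
theorem exists_isKugaSatakeVarietyBetti' {T : Type} [AddCommGroup T] [Module ℚ T] [Module.Finite ℚ T]
    (H : Motives.HodgeStructure T 2) (P : H.Polarization) (hK3 : H.IsOfK3Type)
    (he : ∃ e₁ e₂ : T, P.form e₁ e₂ = 0 ∧ P.form e₁ e₁ < 0 ∧ P.form e₂ e₂ < 0) :
    ∃ (A : Motives.AbelianVariety ℂ) (B : HodgeTheory.HodgeModel A.dim A.X) (hB : B.IsHodgeSymmetric)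
      (θ : Motives.bettiCohomology A.X 1 ≃ₗ[ℚ] CliffordAlgebra.even P.quadraticForm),
      HodgeTheory.IsKugaSatakeVarietyBetti H P hK3.1 A B hB θ :=
  exists_isKugaSatakeVarietyBetti DeligneMilne1982_Thm_6_20_essImage_holds H P hK3 he

/-- **Kuga–Satake varieties exist for EVERY finite-dimensional polarized `ℚ`-Hodge structure of K3 type** —
UNCONDITIONAL form of `exists_isKugaSatakeVarietyBetti_of_isOfK3Type` (the orthogonal negative pair is supplied
by `Polarization.exists_orthogonal_pair_form_self_neg`, vG §5.2; Riemann's theorem by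
`DeligneMilne1982_Thm_6_20_essImage_holds`). [cite: vanGeemen2000KugaSatakeHC, §5.2, §5.7 and §8.1]
[cite: Floccari2026, §3.2] [cite: DeligneMilne1982Tannakian, art. II §6 Thm. 6.20 (Riemann)] -/
theorem exists_isKugaSatakeVarietyBetti_of_isOfK3Type' {T : Type} [AddCommGroup T] [Module ℚ T]
    [Module.Finite ℚ T] (H : Motives.HodgeStructure T 2) (P : H.Polarization) (hK3 : H.IsOfK3Type) :
    ∃ (A : Motives.AbelianVariety ℂ) (B : HodgeTheory.HodgeModel A.dim A.X) (hB : B.IsHodgeSymmetric)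
      (θ : Motives.bettiCohomology A.X 1 ≃ₗ[ℚ] CliffordAlgebra.even P.quadraticForm),
      HodgeTheory.IsKugaSatakeVarietyBetti H P hK3.1 A B hB θ :=
  exists_isKugaSatakeVarietyBetti_of_isOfK3Type DeligneMilne1982_Thm_6_20_essImage_holds H P hK3

section Presentation

variable {S : Motives.SchemeOver ℂ} {hS : Motives.IsSmoothProjective 2 S}
  {M : HodgeModel 2 S} {hM : M.IsHodgeSymmetric}
  {T : Type} [AddCommGroup T] [Module ℚ T] {H : Motives.HodgeStructure T 2} {P : H.Polarization}
  {ε : ℤˣ} {j : H.Hom (bettiTwoHodgeStructure hS M hM)}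

/-- **Kuga–Satake varieties exist for every presentation `(T, H, P, ε, j)` of the transcendental part of a
smooth projective surface with `h^{2,0}(T) = 1`** — UNCONDITIONAL form of
`exists_isKugaSatakeVarietyBetti_of_isTranscendentalPartBetti`: the `∀ (A, B, θ)` binder of the Kuga–Satake
records (`IsKSCorrespondenceAlgebraicBetti`, Floccari 2026 Thm. 3.5) is inhabited for EVERY such presentation,
with no hypothesis left. [cite: vanGeemen2000KugaSatakeHC, §5.7, §8.1 and §10.2] [cite: Floccari2026, §3.2]
[cite: DeligneMilne1982Tannakian, art. II §6 Thm. 6.20 (Riemann)] -/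
theorem exists_isKugaSatakeVarietyBetti_of_isTranscendentalPartBetti'
    (hT : IsTranscendentalPartBetti hS M hM H P ε j) (h20 : H.hodgeNumber 2 0 = 1) :
    ∃ (A : Motives.AbelianVariety ℂ) (B : HodgeTheory.HodgeModel A.dim A.X) (hB : B.IsHodgeSymmetric)
      (θ : Motives.bettiCohomology A.X 1 ≃ₗ[ℚ] CliffordAlgebra.even P.quadraticForm),
      HodgeTheory.IsKugaSatakeVarietyBetti H P h20 A B hB θ :=
  exists_isKugaSatakeVarietyBetti_of_isTranscendentalPartBetti DeligneMilne1982_Thm_6_20_essImage_holds hT h20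

end Presentation

end Literature.AlgebraicGeometry.Surfaces

end
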